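import Summits.MatrixMultiplication.OmegaCensus.DominoZpZpEnum
import HarnessLib

/-!
# The moment-consistency checker for line shadows on `ZMod p × ZMod p` (programs and combinatorial soundness)

ω-census `pub-omega`, family (b3), seat pub-omega-group gen 27.  Framing: lottery ticket; floor = certified bounds/negative
ranges.  VALUE: the generic kernel program (G5 of the SHADOW-CONSISTENCY route, `HOME/pub-omega-group-g26/FAMILY-B-ADDENDUM-g26.md`
§3) that closes a `ℤ_p²` domino cell from a SHORT list of admissible line keys; NOT progress on ω.

Data: a list `Lst` of admissible pairs `(F, s)` (`F : List ℕ` a line key = shadow of the part `X` in one of the `p + 1` directions,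
`s < p` the shift of the normalised line identity) and a list `L0` of representatives.  For a pair `(T₀, T₁) ∈ L0²` placed in the
coordinate directions `u ↦ u.1`, `u ↦ u.2`, the shadows `T_c` in the directions `u ↦ c·u.1 + u.2` (`c = 1, …, p − 1`) are constrained:
`s_c = c·s₀ + s₁`, and the `m`-th power moment `M_m(c)` of `T_c` is the value at `c` of a polynomial of degree `≤ m` whose constant
term `M_m(T₁)` and leading term `c^m·M_m(T₀)` are known (`DominoZpZpMoments.shadow_moment_eq`), so `M_m(1), …, M_m(m−1)` determine
`M_m(c)` for every `c` (Lagrange).  The checker stores, per level `ℓ ≤ M` and shift `s`, the set of digit strings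
`(M_1, …, M_ℓ)` of the listed keys as ONE natural-number bitmask (`Nat.testBit`), and searches order by order (`m = 2, …, M`),
branching over the admissible `m`-th digits of the pivot directions `1, …, m − 1` and PREDICTING the digit of every other
direction; a pair is DEAD when every branch meets an absent digit string.  Here: the programs (`maskOf`, `momN`, `rcode`,
`masksOf`, `lagNum/lagInv/lagTab/invCheck`, `predDigit`, `pivots`, `search`, `pairDead`) and the COMBINATORIAL soundness theorem
`pairDead_sound`: if digit data `dig` (one string per direction) is present in the masks, starts as the checker computes and
obeys the prediction rule, then `pairDead … = true` is impossible.  The algebra (why true shadows obey the rule) is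
`DominoZpZpConsist.lean`.
-/

namespace Summit.MatrixMultiplication.OmegaCensus

open Finset

namespace ZpZpDomino

/-! ## Bitmask sets of naturals -/

/-- Insert the bit positions of `l` into the mask `acc`. [folklore] -/
def maskIns (acc : ℕ) (l : List ℕ) : ℕ := l.foldl (fun m x => m ||| 2 ^ x) acc

/-- Bitmask of a list of bit positions, built by balanced splitting (fuel `n`; any fuel is correct). [folklore] -/
def maskOf : ℕ → List ℕ → ℕ
  | 0, l => maskIns 0 l
  | n + 1, l => if l.length ≤ 32 then maskIns 0 l
      else maskOf n (l.take (l.length / 2)) ||| maskOf n (l.drop (l.length / 2))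

/-- Bits already set or listed are set after `maskIns`. [folklore] -/
theorem testBit_maskIns (l : List ℕ) : ∀ (acc : ℕ) {x : ℕ}, (x ∈ l ∨ acc.testBit x = true) →
    (maskIns acc l).testBit x = true := by
  induction l with
  | nil => intro acc x h; simpa [maskIns] using h
  | cons y l ih =>
    intro acc x h
    show (List.foldl (fun m x => m ||| 2 ^ x) (acc ||| 2 ^ y) l).testBit x = true
    refine ih _ ?_
    rcases h with h | h
    · rcases List.mem_cons.1 h with rfl | h
      · right; rw [Nat.testBit_or, Nat.testBit_two_pow_self, Bool.or_true]
      · exact Or.inl h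
    · right; rw [Nat.testBit_or, h, Bool.true_or]

/-- **Completeness of `maskOf`**: every listed position is set. [folklore] -/
theorem testBit_maskOf : ∀ (n : ℕ) (l : List ℕ) {x : ℕ}, x ∈ l → (maskOf n l).testBit x = true
  | 0, l, x, h => testBit_maskIns l 0 (Or.inl h)
  | n + 1, l, x, h => by
    unfold maskOf
    split_ifs with hl
    · exact testBit_maskIns l 0 (Or.inl h)
    · rw [Nat.testBit_or, Bool.or_eq_true]
      rw [← List.take_append_drop (l.length / 2) l, List.mem_append] at h
      rcases h with h | h
      · exact Or.inl (testBit_maskOf n _ h)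
      · exact Or.inr (testBit_maskOf n _ h)

/-! ## Moments, digit codes and the masks of a key list -/

/-- `m`-th power moment of a line key mod `p`: `(Σ_{v<p} v^m F[v]) % p` (computed with lists). [folklore] -/
def momN (p : ℕ) (F : List ℕ) (m : ℕ) : ℕ := ((List.range p).map fun v => v ^ m * F.getD v 0).sum % p

/-- The moments `M_0, …, M_M` of a key. [folklore] -/
def momList (p M : ℕ) (F : List ℕ) : List ℕ := (List.range (M + 1)).map fun m => momN p F m

/-- Code of the digit string `(M_1, …, M_ℓ)`: `Σ_{i<ℓ} M_{i+1} p^i`. [folklore] -/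
def rcode (p : ℕ) (F : List ℕ) : ℕ → ℕ
  | 0 => 0
  | ℓ + 1 => rcode p F ℓ + momN p F (ℓ + 1) * p ^ ℓ

/-- The masks: entry `[ℓ'][s]` is the set of codes `rcode p F (ℓ' + 1)` over the listed `(F, s')` with `s' % p = s`. [folklore] -/
def masksOf (p M : ℕ) (Lst : List (List ℕ × ℕ)) : List (List ℕ) :=
  (List.range M).map fun ℓ' => (List.range p).map fun s =>
    maskOf 64 ((Lst.filter fun T => T.2 % p = s).map fun T => rcode p T.1 (ℓ' + 1))

/-- Reading an entry of a `map` over `range`. [folklore] -/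
theorem getD_map_range {α : Type*} (f : ℕ → α) {n i : ℕ} (hi : i < n) (d : α) :
    ((List.range n).map f).getD i d = f i := by
  simp [List.getD_eq_getElem?_getD, List.getElem?_range hi]

/-- **Listed keys are present in the masks** at every level. [folklore] -/
theorem testBit_masksOf {p M : ℕ} {Lst : List (List ℕ × ℕ)} {T : List ℕ × ℕ} (hT : T ∈ Lst) {ℓ' : ℕ} (hℓ : ℓ' < M)
    (hp : 0 < p) : Nat.testBit (((masksOf p M Lst).getD ℓ' []).getD (T.2 % p) 0) (rcode p T.1 (ℓ' + 1)) = true := by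
  unfold masksOf
  rw [getD_map_range _ hℓ, getD_map_range _ (Nat.mod_lt _ hp)]
  exact testBit_maskOf 64 _ (List.mem_map.2 ⟨T, List.mem_filter.2 ⟨hT, by simp⟩, rfl⟩)

/-! ## Lagrange coefficients (nodes `0, …, m−1`) with runtime-verified inverses -/

/-- `Π_{j<m, j≠i} (c − j)` mod `p` (computed as `c + p − j`; a `Finset` product — evaluated only `M²·p` times). [folklore] -/
def lagNum (p m i c : ℕ) : ℕ := (∏ j ∈ (Finset.range m).erase i, (c + p - j)) % p

/-- Candidate inverse of `lagNum p m i i` mod `p` (Fermat; only the check `invCheck` is trusted). [folklore] -/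
def lagInv (p m i : ℕ) : ℕ := lagNum p m i i ^ (p - 2) % p

/-- Table `[m][i][c]` of the Lagrange coefficients `lagInv p m i * lagNum p m i c % p`. [folklore] -/
def lagTab (p M : ℕ) : List (List (List ℕ)) :=
  (List.range (M + 1)).map fun m => (List.range m).map fun i => (List.range p).map fun c =>
    lagInv p m i * lagNum p m i c % p

/-- The inverse check: `lagNum p m i i * lagInv p m i ≡ 1 (mod p)` for `1 ≤ i < m ≤ M`. [folklore] -/
def invCheck (p M : ℕ) : Bool :=
  (List.range (M + 1)).all fun m => (List.range m).all fun i => i == 0 || (lagNum p m i i * lagInv p m i) % p == 1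

/-- Predicted `m`-th digit of direction `c` from the pivot values `R[i'] = Q(i'+1)`, `am = M_m(T₀)`, `bm = M_m(T₁)`:
`(c^m·am + bm + Σ_{i'<m−1} R[i']·LC[m][i'+1][c]) % p`. [folklore] -/
def predDigit (p : ℕ) (LC : List (List (List ℕ))) (m c am bm : ℕ) (R : List ℕ) : ℕ :=
  (c ^ m * am + bm + ((List.range (m - 1)).map fun i' => R.getD i' 0 * (((LC.getD m []).getD (i' + 1) []).getD c 0)).sum) % p

/-- The pivot residues `R[i'] = (x_{i'} − ((i'+1)^m·am + bm)) mod p` of chosen digits `xs`. [folklore] -/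
def pivotR (p m am bm : ℕ) (xs : List ℕ) : List ℕ :=
  (List.range (m - 1)).map fun i' => (xs.getD i' 0 + p - (((i' + 1) ^ m * am + bm) % p)) % p

/-! ## The search -/

/-- Branch over the admissible digits (`testBit` in `lvl`, code `rs[k] + x·pm`, shift `ss[k]`) of the pivot directions with
indices `0, …, k−1`; `cont` receives the chosen digits; the result is the conjunction over all choices. [folklore] -/
def pivots (p : ℕ) (lvl : List ℕ) (pm : ℕ) (ss rs : List ℕ) : ℕ → (List ℕ → Bool) → Bool
  | 0, cont => cont []
  | k + 1, cont => pivots p lvl pm ss rs k fun xs =>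
      (List.range p).all fun x => !(Nat.testBit (lvl.getD (ss.getD k 0) 0) (rs.getD k 0 + x * pm)) || cont (xs ++ [x])

/-- The order-by-order search (fuel, current order `m`, codes `rs` of the level-`(m−1)` digit strings of the directions
`c = 1, …, p−1`, index `c − 1`); `true` = DEAD (no consistent completion up to order `M`). [folklore] -/
def search (p M : ℕ) (masks : List (List ℕ)) (LC : List (List (List ℕ))) (a b ss : List ℕ) : ℕ → ℕ → List ℕ → Bool
  | 0, _, _ => false
  | fuel + 1, m, rs =>
    if M < m then false else
      pivots p (masks.getD (m - 1) []) (p ^ (m - 1)) ss rs (m - 1) fun xs =>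
        !((List.range (p - 1)).all fun c' => decide (c' + 1 < m) ||
            Nat.testBit ((masks.getD (m - 1) []).getD (ss.getD c' 0) 0)
              (rs.getD c' 0 + predDigit p LC m (c' + 1) (a.getD m 0) (b.getD m 0) (pivotR p m (a.getD m 0) (b.getD m 0) xs) *
                p ^ (m - 1))) ||
          search p M masks LC a b ss fuel (m + 1) ((List.range (p - 1)).map fun c' =>
            rs.getD c' 0 + (if c' + 1 < m then xs.getD c' 0 else
              predDigit p LC m (c' + 1) (a.getD m 0) (b.getD m 0) (pivotR p m (a.getD m 0) (b.getD m 0) xs)) * p ^ (m - 1))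

/-- The shifts `s_c = c·s₀ + s₁` of the directions `c = c' + 1`. [folklore] -/
def shifts (p s₀ s₁ : ℕ) : List ℕ := (List.range (p - 1)).map fun c' => ((c' + 1) * s₀ + s₁) % p

/-- The first digits `M_1(c) = c·M_1(T₀) + M_1(T₁)`. [folklore] -/
def firstDigits (p a₁ b₁ : ℕ) : List ℕ := (List.range (p - 1)).map fun c' => ((c' + 1) * a₁ + b₁) % p

/-- **The pair check**: `true` = the pair `(T₀, T₁)` (coordinate directions) has no consistent family of listed shadows. [folklore] -/
def pairDead (p M : ℕ) (masks : List (List ℕ)) (LC : List (List (List ℕ))) (T₀ T₁ : List ℕ × ℕ) : Bool :=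
  !((List.range (p - 1)).all fun c' =>
      Nat.testBit ((masks.getD 0 []).getD ((shifts p T₀.2 T₁.2).getD c' 0) 0)
        ((firstDigits p (momN p T₀.1 1) (momN p T₁.1 1)).getD c' 0)) ||
    search p M masks LC (momList p M T₀.1) (momList p M T₁.1) (shifts p T₀.2 T₁.2) M 2
      (firstDigits p (momN p T₀.1 1) (momN p T₁.1 1))

/-- The rows form used by instances: every pair with first component `T₀` is dead. [folklore] -/
def rowDead (p M : ℕ) (Lst L0 : List (List ℕ × ℕ)) (T₀ : List ℕ × ℕ) : Bool :=
  L0.all fun T₁ => pairDead p M (masksOf p M Lst) (lagTab p M) T₀ T₁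

/-- The whole check (one `Bool`; instances prove the rows separately). [folklore] -/
def consistCheck (p M : ℕ) (Lst L0 : List (List ℕ × ℕ)) : Bool :=
  decide (2 ≤ M ∧ M < p) && invCheck p M && L0.all fun T₀ => rowDead p M Lst L0 T₀

/-! ## Combinatorial soundness -/

/-- Code of the first `ℓ` digits `dig 1, …, dig ℓ` of a digit function. [folklore] -/
def dcode (p : ℕ) (dg : ℕ → ℕ) : ℕ → ℕ
  | 0 => 0
  | ℓ + 1 => dcode p dg ℓ + dg (ℓ + 1) * p ^ ℓ

/-- **Specification of `pivots`**: if the branch over all admissible choices returns `true`, the continuation holds at every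
admissible digit vector. [folklore] -/
theorem pivots_spec {p : ℕ} {lvl : List ℕ} {pm : ℕ} {ss rs : List ℕ} :
    ∀ (k : ℕ) (cont : List ℕ → Bool), pivots p lvl pm ss rs k cont = true →
      ∀ xs : List ℕ, xs.length = k →
        (∀ i < k, xs.getD i 0 < p ∧ Nat.testBit (lvl.getD (ss.getD i 0) 0) (rs.getD i 0 + xs.getD i 0 * pm) = true) →
        cont xs = true
  | 0, cont, h, xs, hlen, _ => by
    have : xs = [] := List.eq_nil_of_length_eq_zero hlen
    subst this
    simpa [pivots] using h
  | k + 1, cont, h, xs, hlen, hadm => by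
    have hne : xs ≠ [] := by rintro rfl; simp at hlen
    obtain ⟨ys, x, rfl⟩ : ∃ ys x, xs = ys ++ [x] := ⟨xs.dropLast, xs.getLast hne, (List.dropLast_append_getLast hne).symm⟩
    · simp only [List.length_append, List.length_cons, List.length_nil, zero_add, Nat.add_right_cancel_iff] at hlen
      simp only [pivots] at h
      have hys : ∀ i < k, ys.getD i 0 < p ∧
          Nat.testBit (lvl.getD (ss.getD i 0) 0) (rs.getD i 0 + ys.getD i 0 * pm) = true := by
        intro i hi
        have e : (ys ++ [x]).getD i 0 = ys.getD i 0 := by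
          rw [List.getD_eq_getElem?_getD, List.getElem?_append_left (by rw [hlen]; exact hi),
            ← List.getD_eq_getElem?_getD]
        have := hadm i (Nat.lt_succ_of_lt hi)
        rw [e] at this
        exact this
      have h' := pivots_spec k _ h ys hlen hys
      simp only [List.all_eq_true, List.mem_range, Bool.or_eq_true, Bool.not_eq_true'] at h'
      have hx := hadm k (Nat.lt_succ_self k)
      have e : (ys ++ [x]).getD k 0 = x := by
        rw [List.getD_eq_getElem?_getD, List.getElem?_append_right (by rw [hlen]), hlen, Nat.sub_self]
        simp
      rw [e] at hx
      rcases h' x hx.1 with h'' | h''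
      · rw [hx.2] at h''; exact absurd h'' (by decide)
      · exact h''

/-- **Soundness of the search** against present, rule-obeying digit data.  `dig c' ℓ` is the `ℓ`-th digit of direction
`c' + 1` (`ℓ = 0`: the shift). [folklore] -/
theorem search_sound {p M : ℕ} (hp : 0 < p) (hMp : M < p) {masks : List (List ℕ)} {LC : List (List (List ℕ))}
    {a b : List ℕ}
    (dig : ℕ → ℕ → ℕ) (hlt : ∀ c' ℓ, dig c' ℓ < p)
    (hlag : ∀ m, 2 ≤ m → m ≤ M → ∀ c', m ≤ c' + 1 → c' + 1 < p →
      dig c' m = predDigit p LC m (c' + 1) (a.getD m 0) (b.getD m 0)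
        (pivotR p m (a.getD m 0) (b.getD m 0) ((List.range (m - 1)).map fun i' => dig i' m)))
    (hpres : ∀ c', c' + 1 < p → ∀ ℓ, 1 ≤ ℓ → ℓ ≤ M →
      Nat.testBit ((masks.getD (ℓ - 1) []).getD (dig c' 0) 0) (dcode p (dig c') ℓ) = true)
    {ss : List ℕ} (hss : ∀ c', c' + 1 < p → ss.getD c' 0 = dig c' 0) :
    ∀ (fuel m : ℕ) (rs : List ℕ), 2 ≤ m → (∀ c', c' + 1 < p → rs.getD c' 0 = dcode p (dig c') (m - 1)) →
      search p M masks LC a b ss fuel m rs = true → False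
  | 0, m, rs, _, _, h => by simp [search] at h
  | fuel + 1, m, rs, hm, hrs, h => by
    rw [search] at h
    by_cases hMm' : M < m
    · rw [if_pos hMm'] at h; exact Bool.false_ne_true h
    rw [if_neg hMm'] at h
    have hMm : m ≤ M := not_lt.1 hMm'
    -- the true order-`m` digits of the pivots are admissible
    set xs₀ : List ℕ := (List.range (m - 1)).map fun i' => dig i' m with hxs₀
    have hxlen : xs₀.length = m - 1 := by simp [hxs₀]
    have hxget : ∀ i < m - 1, xs₀.getD i 0 = dig i m := fun i hi => by rw [hxs₀, getD_map_range _ hi]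
    have hcode : ∀ c', c' + 1 < p → rs.getD c' 0 + dig c' m * p ^ (m - 1) = dcode p (dig c') m := by
      intro c' hc'
      rw [hrs c' hc']
      obtain ⟨m', rfl⟩ : ∃ m', m = m' + 1 := ⟨m - 1, by omega⟩
      simp [dcode]
    have hadm : ∀ i < m - 1, xs₀.getD i 0 < p ∧
        Nat.testBit ((masks.getD (m - 1) []).getD (ss.getD i 0) 0) (rs.getD i 0 + xs₀.getD i 0 * p ^ (m - 1)) = true := by
      intro i hi
      have hi' : i + 1 < p := by omega
      refine ⟨by rw [hxget i hi]; exact hlt _ _, ?_⟩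
      rw [hxget i hi, hss i hi', hcode i hi']
      have := hpres i hi' m (by omega) hMm
      exact this
    have hcont := pivots_spec (m - 1) _ h xs₀ hxlen hadm
    -- unfold the continuation at the true digits
    simp only [Bool.or_eq_true, Bool.not_eq_true'] at hcont
    have hpred : ∀ c', m ≤ c' + 1 → c' + 1 < p →
        predDigit p LC m (c' + 1) (a.getD m 0) (b.getD m 0) (pivotR p m (a.getD m 0) (b.getD m 0) xs₀) = dig c' m :=
      fun c' h1 h2 => (hlag m hm hMm c' h1 h2).symm
    rcases hcont with hc | hc
    · -- some predicted digit string would be absent: impossible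
      rw [← Bool.not_eq_true, List.all_eq_true] at hc
      apply hc
      intro c' hc'
      rw [List.mem_range] at hc'
      have hc'' : c' + 1 < p := by omega
      rw [Bool.or_eq_true, decide_eq_true_eq]
      by_cases hlt' : c' + 1 < m
      · exact Or.inl hlt'
      · right
        have hlt' : m ≤ c' + 1 := not_lt.1 hlt'
        rw [hpred c' hlt' hc'', hss c' hc'', hcode c' hc'']
        exact hpres c' hc'' m (by omega) hMm
    · -- recurse at order `m + 1` with the true level-`m` codes
      refine search_sound hp hMp dig hlt hlag hpres hss fuel (m + 1) _ (by omega) (fun c' hc' => ?_) hc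
      rw [getD_map_range _ (by omega), Nat.add_sub_cancel]
      split_ifs with hlt'
      · rw [hxget c' (by omega)]; exact hcode c' hc'
      · rw [hpred c' (not_lt.1 hlt') hc']; exact hcode c' hc'

/-- **Soundness of the pair check** (combinatorial form): digit data `dig` that is present in the masks at every level
`1 ≤ ℓ ≤ M`, has the shifts `c·s₀ + s₁` and first digits `c·M_1(T₀) + M_1(T₁)`, and obeys the prediction rule at every order
`2 ≤ m ≤ M`, refutes `pairDead … T₀ T₁ = true`. [folklore] -/
theorem pairDead_sound {p M : ℕ} (hp : 0 < p) (hM : 1 ≤ M) (hMp : M < p) {masks : List (List ℕ)}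
    {LC : List (List (List ℕ))}
    {T₀ T₁ : List ℕ × ℕ} (dig : ℕ → ℕ → ℕ) (hlt : ∀ c' ℓ, dig c' ℓ < p)
    (h0 : ∀ c', c' + 1 < p → dig c' 0 = ((c' + 1) * T₀.2 + T₁.2) % p)
    (h1 : ∀ c', c' + 1 < p → dig c' 1 = ((c' + 1) * momN p T₀.1 1 + momN p T₁.1 1) % p)
    (hlag : ∀ m, 2 ≤ m → m ≤ M → ∀ c', m ≤ c' + 1 → c' + 1 < p →
      dig c' m = predDigit p LC m (c' + 1) (momN p T₀.1 m) (momN p T₁.1 m)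
        (pivotR p m (momN p T₀.1 m) (momN p T₁.1 m) ((List.range (m - 1)).map fun i' => dig i' m)))
    (hpres : ∀ c', c' + 1 < p → ∀ ℓ, 1 ≤ ℓ → ℓ ≤ M →
      Nat.testBit ((masks.getD (ℓ - 1) []).getD (dig c' 0) 0) (dcode p (dig c') ℓ) = true)
    (h : pairDead p M masks LC T₀ T₁ = true) : False := by
  unfold pairDead at h
  rw [Bool.or_eq_true, Bool.not_eq_true'] at h
  have hss : ∀ c', c' + 1 < p → (shifts p T₀.2 T₁.2).getD c' 0 = dig c' 0 := fun c' hc' => by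
    rw [shifts, getD_map_range _ (by omega), h0 c' hc']
  have hfd : ∀ c', c' + 1 < p → (firstDigits p (momN p T₀.1 1) (momN p T₁.1 1)).getD c' 0 = dcode p (dig c') 1 :=
    fun c' hc' => by
      rw [firstDigits, getD_map_range _ (by omega), ← h1 c' hc']
      simp [dcode]
  rcases h with h | h
  · rw [← Bool.not_eq_true, List.all_eq_true] at h
    apply h
    intro c' hc'
    rw [List.mem_range] at hc'
    have hc'' : c' + 1 < p := by omega
    rw [hss c' hc'', hfd c' hc'']
    exact hpres c' hc'' 1 le_rfl hM
  · refine search_sound hp hMp dig hlt (fun m hm hmM c' h1 h2 => ?_) hpres hss M 2 _ le_rfl (fun c' hc' => hfd c' hc') h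
    have ea : (momList p M T₀.1).getD m 0 = momN p T₀.1 m := by rw [momList, getD_map_range _ (by omega)]
    have eb : (momList p M T₁.1).getD m 0 = momN p T₁.1 m := by rw [momList, getD_map_range _ (by omega)]
    rw [ea, eb]
    exact hlag m hm hmM c' h1 h2

end ZpZpDomino

end Summit.MatrixMultiplication.OmegaCensus
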